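import Mathlib

/-!
# Tier4/Line3/LocalOrbitBounded — lemma L3.d `local_orbit_bounded` of LINE L3

Blind re-derivation cell `pub-hodge-repro`, Tier 4 «PROVE THE STEP» (README §9–§10), seat t4-L3-p2 (gen 0),
seated against LINE L3 (`Tier4/Line3/Skeleton.lean` v0.5, sha256 ff05083c…, lead S12017: «t4-L3-p2 takes L3.d»).

THE LEMMA (Skeleton.lean v0.5 L451–L458, signature verbatim): over a normed field `K`, if the two Schrödinger
components `X₁, X₂ ∈ M_{3×4}(K)` each have an invertible `3×3` minor (columns `s₁`, resp. `s₂`), then the set of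
`g ∈ GL₃(K)` with `g X₁` and `g⁻ᵀ X₂` entrywise bounded by `1` has `g` and `g⁻¹` entrywise bounded by one constant
`C` depending only on `X₁, X₂, s₁, s₂` — so the local orbital integral of step 2 of the line is over a compact set.

PROOF.  Write `S₁ := X₁.submatrix id s₁` (a unit, so `det S₁` is a unit).  Then `g = (g S₁) S₁⁻¹`, and every entry
of `g S₁` is the entry of `g X₁` in column `s₁ k`, hence of norm `≤ 1`; so
`‖g i j‖ ≤ Σ_k ‖(g S₁) i k‖ ‖S₁⁻¹ k j‖ ≤ Σ_k ‖S₁⁻¹ k j‖ ≤ Σ_{k,l} ‖S₁⁻¹ k l‖ =: C₁`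
(`entry_bound_of_submatrix_isUnit`).  The same argument for `A := (g⁻¹)ᵀ` against `X₂, s₂` gives
`‖g⁻¹ i j‖ = ‖A j i‖ ≤ C₂ := Σ_{k,l} ‖S₂⁻¹ k l‖`, and `C := C₁ + C₂` (both non-negative) bounds both.
The hypothesis `IsUnit g` of the statement is not needed by this argument (it is discarded in the proof).

No printed input; Mathlib only (`Matrix.isUnit_iff_isUnit_det`, `Matrix.mul_nonsing_inv_cancel_right`,
`norm_sum_le`, `Finset.single_le_sum`).  Nothing here says anything about the status of the Hodge conjecture for CM
abelian varieties, which is NOT proved (HC_CM is NOT proved by anyone in this repository).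
-/

set_option autoImplicit false

noncomputable section

namespace Summit.Ventures.HodgeRepro.Tier4.Line3

open Matrix

/-- **Entry bound from an invertible minor.** If `A * X` is entrywise bounded by `1` and the `3×3` minor
`S := X.submatrix id s` of `X` is a unit, then every entry of `A = (A * S) * S⁻¹` is bounded by the sum of the norms
of the entries of `S⁻¹`. -/
theorem entry_bound_of_submatrix_isUnit {K : Type} [NormedField K]
    (A : Matrix (Fin 3) (Fin 3) K) (X : Matrix (Fin 3) (Fin 4) K) (s : Fin 3 → Fin 4)
    (hs : IsUnit (X.submatrix id s)) (hAX : ∀ i j, ‖(A * X) i j‖ ≤ 1) (i j : Fin 3) :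
    ‖A i j‖ ≤ ∑ k : Fin 3, ∑ l : Fin 3, ‖(X.submatrix id s)⁻¹ k l‖ := by
  set S : Matrix (Fin 3) (Fin 3) K := X.submatrix id s with hS
  have hdet : IsUnit S.det := (Matrix.isUnit_iff_isUnit_det S).mp hs
  have hA : A = (A * S) * S⁻¹ := (Matrix.mul_nonsing_inv_cancel_right S A hdet).symm
  have hAS : ∀ i k, ‖(A * S) i k‖ ≤ 1 := by
    intro i k
    have h : (A * S) i k = (A * X) i (s k) := by
      simp only [hS, Matrix.mul_apply, Matrix.submatrix_apply, id]
    rw [h]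
    exact hAX i (s k)
  calc ‖A i j‖ = ‖∑ k, (A * S) i k * S⁻¹ k j‖ := by
        conv_lhs => rw [hA]
        rw [Matrix.mul_apply]
    _ ≤ ∑ k, ‖(A * S) i k * S⁻¹ k j‖ := norm_sum_le _ _
    _ = ∑ k, ‖(A * S) i k‖ * ‖S⁻¹ k j‖ := by
        simp only [norm_mul]
    _ ≤ ∑ k, 1 * ‖S⁻¹ k j‖ := by
        apply Finset.sum_le_sum
        intro k _
        exact mul_le_mul_of_nonneg_right (hAS i k) (norm_nonneg _)
    _ = ∑ k, ‖S⁻¹ k j‖ := by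
        simp only [one_mul]
    _ ≤ ∑ k, ∑ l, ‖S⁻¹ k l‖ := by
        apply Finset.sum_le_sum
        intro k _
        exact Finset.single_le_sum (f := fun l => ‖S⁻¹ k l‖) (fun l _ => norm_nonneg _)
          (Finset.mem_univ j)

/-- L3.d LOCAL COMPACTNESS OF THE GENERIC ORBIT (cut for provers; step 2 at a split place, Mathlib-level): over a
normed field, if the two Schrödinger components `X₁, X₂ ∈ M_{3×4}` have rank `3` (an invertible `3×3` minor each),
the set of `g ∈ GL_3` with `g X₁` and `g⁻ᵀ X₂` entrywise bounded by `1` has `g` and `g⁻¹` entrywise bounded — so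
the local orbital integral `∫ |det g|² 1_{L⁴}(g X₁) 1_{L⁴}(g⁻ᵀ X₂) dg` is over a compact set.  (`g = (g X₁ S)(X₁ S)⁻¹`
and `g⁻ᵀ = (g⁻ᵀ X₂ S′)(X₂ S′)⁻¹` on the minors `S, S′`.)  Statement verbatim from `Tier4/Line3/Skeleton.lean` v0.5. -/
theorem local_orbit_bounded {K : Type} [NormedField K] (X₁ X₂ : Matrix (Fin 3) (Fin 4) K)
    (s₁ s₂ : Fin 3 → Fin 4) (h₁ : IsUnit (X₁.submatrix id s₁)) (h₂ : IsUnit (X₂.submatrix id s₂)) :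
    ∃ C : ℝ, ∀ g : Matrix (Fin 3) (Fin 3) K, IsUnit g →
      (∀ i j, ‖(g * X₁) i j‖ ≤ 1) → (∀ i j, ‖(g⁻¹ᵀ * X₂) i j‖ ≤ 1) →
      ∀ i j, ‖g i j‖ ≤ C ∧ ‖g⁻¹ i j‖ ≤ C := by
  refine ⟨(∑ k : Fin 3, ∑ l : Fin 3, ‖(X₁.submatrix id s₁)⁻¹ k l‖) +
      (∑ k : Fin 3, ∑ l : Fin 3, ‖(X₂.submatrix id s₂)⁻¹ k l‖), ?_⟩
  intro g _hg hX₁ hX₂ i j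
  have hC₁ : 0 ≤ ∑ k : Fin 3, ∑ l : Fin 3, ‖(X₁.submatrix id s₁)⁻¹ k l‖ :=
    Finset.sum_nonneg fun _ _ => Finset.sum_nonneg fun _ _ => norm_nonneg _
  have hC₂ : 0 ≤ ∑ k : Fin 3, ∑ l : Fin 3, ‖(X₂.submatrix id s₂)⁻¹ k l‖ :=
    Finset.sum_nonneg fun _ _ => Finset.sum_nonneg fun _ _ => norm_nonneg _
  constructor
  · have h := entry_bound_of_submatrix_isUnit g X₁ s₁ h₁ hX₁ i j
    linarith
  · have h := entry_bound_of_submatrix_isUnit (g⁻¹ᵀ) X₂ s₂ h₂ hX₂ j i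
    rw [Matrix.transpose_apply] at h
    linarith

end Summit.Ventures.HodgeRepro.Tier4.Line3

end
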